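import Literature.MathematicalPhysics.QuantumFieldTheory.Balaban1983to89.B3OddVectorLoops
import Literature.MathematicalPhysics.QuantumFieldTheory.Balaban1983to89.B3IGraph

/-!
# `Balaban1983to89.B3AttachCounterterm` — T. Bałaban, *(Higgs)₂,₃ quantum fields in a finite volume. III. Renormalization*,
Commun. Math. Phys. **88** (1983) 411–445 [Balaban1983Higgs3]: p. 423, the graph surgery behind (2.3) — *"attaching the
corresponding graphs to the mass renormalization vertices"* — on the concrete model `B3Cor23Concrete`

statement-level skeleton of published theorems with citation tags; proofs where landed; nothing here is a claim about the Yang–Mills mass gap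

PDF held: `paper:balaban1983-higgs-2-3-quantum-fields-finite-volume` (journal page = PDF page + 410); renders read as images:
`…/b2b-balaban-ref1/pages/1983-cmp88-higgs23-III/1983-cmp88-higgs23-III-p006, p007, p013-x2.png` (pp. 416, 417, 423).
CITATION HEADER (lean-in-tree rule).  lit-balaban TYPED SKELETON (HOME `run/shared/lean/pub/lit-balaban/`), Phase 2, seat p18
(gen 4), unit `lit-balaban-p18`: SKELETON row **B3.Eq2.2-2.3** (owner r15; decls of record `B3Sect2Statements.graphDegree`,
`graphDegree_eq_22`), p. 423 [PDF 13], verbatim: *"If we have a counterterm from δm_k², then it corresponds to some graph G₀ and we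
define a degree of this counterterm as the degree of the graph G₀. … In the general case we take the following definition, which
in fact is an inductive definition: D(G) = Σ_{v∈G} D_G(v) − d + (a sum of degrees of mass renormalization counterterms connected
with the vertices of the graph G). (2.3) Thus the degree of G is the same as the degree of a graph G′ obtained from G by attaching
the corresponding graphs to the mass renormalization vertices."*  THIS MODULE constructs the graph G′ of the last sentence for ONE
mass renormalization vertex (the general case is an iteration): the (1.7)-vertex `v` of G is deleted and the counterterm graph H
(the graph G₀ of δm²_{G₀}: by (1.21)–(1.23) pp. 416–417 a graph of the self-energy Σ_ε with two external, undifferentiated φ′-legs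
x₀, x₁ — *"the graph corresponding to δm_G is the same as for Σ_{εG}"*, p. 417) is inserted, its legs x₀, x₁ taking over the
scalar lines that ended at the two φ′-legs of `v` (when the two legs of `v` are joined to each other, x₀ is joined to x₁; when a
leg of `v` is external, the corresponding x stays external).  The sibling `B3AttachCountertermDegree` proves the sentence:
D(G′) computed by (2.2) equals (2.3) for G, i.e. D(G) [counterterm degree 0 at v, the model's `Graph.deg`] + D(H).

WHAT IS FORMALISED (sorry-free; `def`s with bodies only, no `Prop` fact).  Over `B3IGraph.IGraph` (graphs of the model with an
arbitrary finite vertex type; the surgery produces the vertex set {w ≠ v} ⊕ (vertices of H)): `AttachData G H` (the vertex v of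
kind (1.7), the two distinct external undifferentiated φ′-legs `x 0`, `x 1` of H); the attached graph `attach A : IGraph nbar
({w // w ≠ A.v} ⊕ Fin H.nV)` with its four structure axioms PROVED (`other_ne`, `other_symm`, `other_isLeft`, `exists_line`) — the
surgery is a genuine graph of the model's kind.
-/

namespace Literature.MathematicalPhysics.QuantumFieldTheory.Balaban1983to89.B3AttachCounterterm

open Finset B3Prop1 B3Sect2Statements B3VertexBridge B3Cor23Concrete B3OddVectorLoops B3IGraph

variable {nbar : ℕ}

/-! ## The data of one attachment -/

/-- The data of one attachment (p. 423 with pp. 416–417): a mass renormalization vertex `v` (kind (1.7)) of G and, in the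
counterterm graph H (a graph of Σ_ε, (1.21)), its two distinct external φ′-legs `x 0`, `x 1`, which carry no differentiation.
[cite: Balaban1983Higgs3, (2.3) p.423] -/
structure AttachData (G H : Graph nbar) where
  /-- the mass renormalization vertex of G -/
  v : Fin G.nV
  /-- it is a vertex (1.7) -/
  hv : G.kind v = .v17
  /-- the two external φ′-legs of the counterterm graph -/
  x : Fin 2 → SLeg H
  /-- they are distinct -/
  x_inj : Function.Injective x
  /-- they are external in H -/
  ext : ∀ k, H.other ⟨(x k).1, .inl (x k).2⟩ = none
  /-- they carry no differentiation (a leg of index 0 of a vertex (1.8)/(1.9) is its D^η_B̃φ′-leg) -/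
  undiff : ∀ k, ((x k).2 : ℕ) = 0 → (H.kind (x k).1).diffCount = 0

namespace AttachData

variable {G H : Graph nbar} (A : AttachData G H)

/-- kernel: the vertex (1.7) has two φ′-legs. [cite: Balaban1983Higgs3, (1.7) p.413] -/
theorem two_eq : 2 = (G.kind A.v).scalarLegs := by rw [A.hv]; rfl

/-- kernel: the vertex (1.7) has no A′-legs. [cite: Balaban1983Higgs3, (1.7) p.413] -/
theorem vec_eq : (G.kind A.v).vectorLegs = 0 := by rw [A.hv]; rfl

/-- The two φ′-legs of the vertex v, as legs of G. [cite: Balaban1983Higgs3, (1.7) p.413] -/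
def leg (k : Fin 2) : Leg G.kind := ⟨A.v, .inl (Fin.cast A.two_eq k)⟩

/-- The two attachment legs of H, as legs of H. [cite: Balaban1983Higgs3, (2.3) p.423] -/
def xleg (k : Fin 2) : Leg H.kind := ⟨(A.x k).1, .inl (A.x k).2⟩

/-- The vertices of the attached graph: those of G other than v, and those of H. [cite: Balaban1983Higgs3, (2.3) p.423] -/
def kind' : {w : Fin G.nV // w ≠ A.v} ⊕ Fin H.nV → VertexKind := Sum.elim (fun w => G.kind w.1) H.kind

/-- The attachment legs inside the attached graph. [cite: Balaban1983Higgs3, (2.3) p.423] -/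
def X (k : Fin 2) : ILeg A.kind' := ⟨Sum.inr (A.x k).1, Sum.inl (A.x k).2⟩

/-- Which leg of v (0 or 1) a leg position is. [cite: Balaban1983Higgs3, (1.7) p.413] -/
def legIdx {a b : ℕ} (s : Fin a ⊕ Fin b) : Fin 2 := if Sum.elim Fin.val Fin.val s = 0 then 0 else 1

/-- The legs of G inside the attached graph: a leg of a vertex w ≠ v is kept; the leg k of v is REPLACED by the attachment leg
x k of H (this reroutes the lines of G ending at v into H). [cite: Balaban1983Higgs3, (2.3) p.423] -/
def embG : Leg G.kind → ILeg A.kind'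
  | ⟨u, s⟩ => if h : u = A.v then A.X (legIdx s) else ⟨Sum.inl ⟨u, h⟩, s⟩

/-- The legs of H inside the attached graph. [cite: Balaban1983Higgs3, (2.3) p.423] -/
def embH : Leg H.kind → ILeg A.kind'
  | ⟨u, s⟩ => ⟨Sum.inr u, s⟩

/-- Reading a leg of the attached graph back in G (none for legs of H). [cite: Balaban1983Higgs3, (2.3) p.423] -/
def projG : ILeg A.kind' → Option (Leg G.kind)
  | ⟨Sum.inl w, s⟩ => some ⟨w.1, s⟩
  | ⟨Sum.inr _, _⟩ => none

/-- Reading a leg of the attached graph back in H (none for legs of G). [cite: Balaban1983Higgs3, (2.3) p.423] -/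
def projH : ILeg A.kind' → Option (Leg H.kind)
  | ⟨Sum.inl _, _⟩ => none
  | ⟨Sum.inr u, s⟩ => some ⟨u, s⟩

/-- The lines of the attached graph G′ (p. 423 *"obtained from G by attaching the corresponding graphs to the mass
renormalization vertices"*): a leg of an old vertex keeps its line of G (rerouted into H if it ended at v); the attachment leg
x k takes over the line of G that ended at the leg k of v; every other leg of H keeps its line of H.
[cite: Balaban1983Higgs3, (2.3) p.423] -/
def other' : ILeg A.kind' → Option (ILeg A.kind')
  | ⟨Sum.inl w, s⟩ => (G.other ⟨w.1, s⟩).map A.embG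
  | ⟨Sum.inr u, s⟩ =>
      if (⟨u, s⟩ : Leg H.kind) = A.xleg 0 then (G.other (A.leg 0)).map A.embG
      else if (⟨u, s⟩ : Leg H.kind) = A.xleg 1 then (G.other (A.leg 1)).map A.embG
      else (H.other ⟨u, s⟩).map A.embH

/-! ### Bookkeeping of the embeddings -/

/-- kernel: every leg of v is its leg 0 or its leg 1. [cite: Balaban1983Higgs3, (1.7) p.413] -/
theorem exists_leg_eq (s : Fin (G.kind A.v).scalarLegs ⊕ Fin (G.kind A.v).vectorLegs) :
    ∃ k, (⟨A.v, s⟩ : Leg G.kind) = A.leg k ∧ legIdx s = k := by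
  rcases s with j | j
  · have hj : (j : ℕ) < 2 := by rw [A.two_eq]; exact j.isLt
    refine ⟨⟨j, hj⟩, ?_, ?_⟩
    · show (⟨A.v, Sum.inl j⟩ : Leg G.kind) = ⟨A.v, Sum.inl (Fin.cast A.two_eq ⟨j, hj⟩)⟩
      rfl
    · apply Fin.ext
      unfold legIdx
      split_ifs with h
      · simpa using h.symm
      · simp only [Sum.elim_inl] at h
        show (1 : ℕ) = j
        omega
  · exact absurd j.isLt (by have := A.vec_eq; omega)

/-- kernel: the embedding of a leg of a vertex other than v. [cite: Balaban1983Higgs3, (2.3) p.423] -/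
theorem embG_of_ne {u : Fin G.nV} (h : u ≠ A.v) (s : Fin (G.kind u).scalarLegs ⊕ Fin (G.kind u).vectorLegs) :
    A.embG ⟨u, s⟩ = ⟨Sum.inl ⟨u, h⟩, s⟩ := by
  simp [embG, h]

/-- kernel: the leg k of v has index k. [cite: Balaban1983Higgs3, (1.7) p.413] -/
theorem legIdx_leg (k : Fin 2) :
    legIdx (Sum.inl (Fin.cast A.two_eq k) : Fin (G.kind A.v).scalarLegs ⊕ Fin (G.kind A.v).vectorLegs) = k := by
  apply Fin.ext; unfold legIdx; fin_cases k <;> simp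

/-- kernel: the embedding of the leg k of v is the attachment leg x k. [cite: Balaban1983Higgs3, (2.3) p.423] -/
theorem embG_leg (k : Fin 2) : A.embG (A.leg k) = A.X k := by
  simp only [leg, embG, legIdx_leg]
  exact dif_pos trivial

/-- kernel: a leg of G at v embeds to an attachment leg, a leg elsewhere to an old leg. [cite: Balaban1983Higgs3, (2.3) p.423] -/
theorem embG_cases (p : Leg G.kind) :
    (∃ k, p = A.leg k ∧ A.embG p = A.X k) ∨ (∃ h : p.1 ≠ A.v, A.embG p = ⟨Sum.inl ⟨p.1, h⟩, p.2⟩) := by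
  obtain ⟨u, s⟩ := p
  by_cases h : u = A.v
  · subst h
    obtain ⟨k, hk, -⟩ := A.exists_leg_eq s
    exact Or.inl ⟨k, hk, by rw [hk, embG_leg]⟩
  · exact Or.inr ⟨h, A.embG_of_ne h s⟩

/-- kernel: `projG` inverts `embG` away from v. [cite: Balaban1983Higgs3, (2.3) p.423] -/
theorem projG_embG_of_ne {p : Leg G.kind} (h : p.1 ≠ A.v) : A.projG (A.embG p) = some p := by
  obtain ⟨u, s⟩ := p
  rw [A.embG_of_ne h]; rfl

/-- kernel: attachment legs are not old legs. [cite: Balaban1983Higgs3, (2.3) p.423] -/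
theorem projG_X (k : Fin 2) : A.projG (A.X k) = none := rfl

/-- kernel: `projH` inverts `embH`. [cite: Balaban1983Higgs3, (2.3) p.423] -/
theorem projH_embH (p : Leg H.kind) : A.projH (A.embH p) = some p := by
  obtain ⟨u, s⟩ := p; rfl

/-- kernel: the attachment leg read back in H. [cite: Balaban1983Higgs3, (2.3) p.423] -/
theorem projH_X (k : Fin 2) : A.projH (A.X k) = some (A.xleg k) := rfl

/-- kernel: `embH` of an attachment leg. [cite: Balaban1983Higgs3, (2.3) p.423] -/
theorem embH_xleg (k : Fin 2) : A.embH (A.xleg k) = A.X k := rfl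

/-- kernel: old legs are not legs of H. [cite: Balaban1983Higgs3, (2.3) p.423] -/
theorem projH_embG_of_ne {p : Leg G.kind} (h : p.1 ≠ A.v) : A.projH (A.embG p) = none := by
  obtain ⟨u, s⟩ := p
  rw [A.embG_of_ne h]; rfl

/-- kernel: the legs of v are distinct for distinct indices. [cite: Balaban1983Higgs3, (1.7) p.413] -/
theorem leg_injective : Function.Injective A.leg := by
  intro k k' h
  have := congrArg (fun l : Leg G.kind => Sum.elim Fin.val Fin.val l.2) h
  exact Fin.ext (by simpa [leg] using this)

/-- Reading a leg of H as a φ′-leg (none for A′-legs). [cite: Balaban1983Higgs3, (1.17) p.415] -/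
def toS : Leg H.kind → Option (SLeg H)
  | ⟨i, .inl j⟩ => some ⟨i, j⟩
  | ⟨_, .inr _⟩ => none

/-- kernel: an attachment leg read as a φ′-leg. [cite: Balaban1983Higgs3, (2.3) p.423] -/
theorem toS_xleg (k : Fin 2) : toS (A.xleg k) = some (A.x k) := rfl

/-- kernel: the attachment legs are distinct for distinct indices. [cite: Balaban1983Higgs3, (2.3) p.423] -/
theorem xleg_injective : Function.Injective A.xleg := fun k k' h =>
  A.x_inj (Option.some.inj ((A.toS_xleg k).symm.trans ((congrArg toS h).trans (A.toS_xleg k'))))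

/-- kernel: `Option.map` hits `some` only from `some`. [cite: Balaban1983Higgs3, (2.3) p.423] -/
theorem map_eq_some {α β : Type} {f : α → β} {o : Option α} {b : β} (h : o.map f = some b) :
    ∃ a, o = some a ∧ f a = b := by
  cases o with
  | none => exact absurd h (by simp)
  | some a => exact ⟨a, rfl, by simpa using h⟩

/-- kernel: the attachment legs inside G′ are distinct for distinct indices. [cite: Balaban1983Higgs3, (2.3) p.423] -/
theorem X_injective : Function.Injective A.X := fun k k' h =>
  A.xleg_injective (Option.some.inj ((A.projH_X k).symm.trans ((congrArg A.projH h).trans (A.projH_X k'))))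

/-- kernel: an internal leg of H is not an attachment leg (those are external in H). [cite: Balaban1983Higgs3, (2.3) p.423] -/
theorem ne_xleg_of_isSome {l : Leg H.kind} (h : (H.other l).isSome) (k : Fin 2) : l ≠ A.xleg k := by
  rintro rfl
  simp [xleg, A.ext k] at h

/-- kernel: the partner of a leg in H is not an attachment leg. [cite: Balaban1983Higgs3, (2.3) p.423] -/
theorem ne_xleg_of_other {l p : Leg H.kind} (h : H.other l = some p) (k : Fin 2) : p ≠ A.xleg k :=
  A.ne_xleg_of_isSome (by rw [H.other_symm _ _ h]; rfl) k

/-- kernel: the line at an old leg. [cite: Balaban1983Higgs3, (2.3) p.423] -/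
theorem other'_inl (w : {w : Fin G.nV // w ≠ A.v}) (s : Fin (G.kind w.1).scalarLegs ⊕ Fin (G.kind w.1).vectorLegs) :
    A.other' ⟨Sum.inl w, s⟩ = (G.other ⟨w.1, s⟩).map A.embG := rfl

/-- kernel: the line at an attachment leg is the (rerouted) line of G at the corresponding leg of v.
[cite: Balaban1983Higgs3, (2.3) p.423] -/
theorem other'_X (k : Fin 2) : A.other' (A.X k) = (G.other (A.leg k)).map A.embG := by
  show A.other' ⟨Sum.inr (A.x k).1, Sum.inl (A.x k).2⟩ = _
  simp only [other']
  split_ifs with h0 h1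
  · rw [A.xleg_injective (h0 : A.xleg k = A.xleg 0)]
  · rw [A.xleg_injective (h1 : A.xleg k = A.xleg 1)]
  · exfalso
    fin_cases k
    · exact h0 rfl
    · exact h1 rfl

/-- kernel: the line at a leg of H other than the attachment legs is its line of H. [cite: Balaban1983Higgs3, (2.3) p.423] -/
theorem other'_embH {l : Leg H.kind} (h : ∀ k, l ≠ A.xleg k) : A.other' (A.embH l) = (H.other l).map A.embH := by
  obtain ⟨u, s⟩ := l
  show A.other' ⟨Sum.inr u, s⟩ = _
  simp only [other']
  rw [if_neg (h 0), if_neg (h 1)]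

/-- kernel: every leg of the attached graph is an old leg, an attachment leg, or another leg of H.
[cite: Balaban1983Higgs3, (2.3) p.423] -/
theorem leg_cases (l : ILeg A.kind') :
    (∃ w s, l = ⟨Sum.inl w, s⟩) ∨ (∃ k, l = A.X k) ∨ (∃ l' : Leg H.kind, (∀ k, l' ≠ A.xleg k) ∧ l = A.embH l') := by
  obtain ⟨i, s⟩ := l
  rcases i with w | u
  · exact Or.inl ⟨w, s, rfl⟩
  · by_cases h : ∃ k, (⟨u, s⟩ : Leg H.kind) = A.xleg k
    · obtain ⟨k, hk⟩ := h
      exact Or.inr (Or.inl ⟨k, (congrArg A.embH hk).trans (A.embH_xleg k)⟩)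
    · exact Or.inr (Or.inr ⟨⟨u, s⟩, fun k hk => h ⟨k, hk⟩, rfl⟩)

/-! ### The structure axioms of the attached graph -/

/-- kernel: the lines of G′ join scalar legs to scalar legs and vector legs to vector legs. [cite: Balaban1983Higgs3, p.414] -/
theorem isLeft_embG (p : Leg G.kind) : (A.embG p).2.isLeft = p.2.isLeft := by
  rcases A.embG_cases p with ⟨k, rfl, h⟩ | ⟨h, h'⟩
  · rw [h]; rfl
  · rw [h']; rfl

/-- kernel: symmetry of the lines of G′ at an old leg. [cite: Balaban1983Higgs3, p.415] -/
theorem other'_embG_of_other {q p : Leg G.kind} (h : G.other q = some p) :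
    A.other' (A.embG p) = some (A.embG q) := by
  have hs := G.other_symm _ _ h
  rcases A.embG_cases p with ⟨k, rfl, hk⟩ | ⟨hp, hp'⟩
  · rw [hk, A.other'_X k, hs]; rfl
  · rw [hp']
    show (G.other ⟨p.1, p.2⟩).map A.embG = _
    rw [show (⟨p.1, p.2⟩ : Leg G.kind) = p from rfl, hs]; rfl

/-- kernel: "the other endpoint" of G′ is symmetric. [cite: Balaban1983Higgs3, p.415] -/
theorem other'_symm (l l' : ILeg A.kind') (h : A.other' l = some l') : A.other' l' = some l := by
  rcases A.leg_cases l with ⟨w, s, rfl⟩ | ⟨k, rfl⟩ | ⟨m, hm, rfl⟩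
  · rw [A.other'_inl] at h
    obtain ⟨p, hp, rfl⟩ := map_eq_some h
    rw [A.other'_embG_of_other hp, A.embG_of_ne w.2]
  · rw [A.other'_X] at h
    obtain ⟨p, hp, rfl⟩ := map_eq_some h
    rcases A.embG_cases p with ⟨k', rfl, hk⟩ | ⟨hpv, hp'⟩
    · rw [hk, A.other'_X k', G.other_symm _ _ hp]; exact congrArg some (A.embG_leg k)
    · rw [hp']
      show (G.other ⟨p.1, p.2⟩).map A.embG = _
      rw [show (⟨p.1, p.2⟩ : Leg G.kind) = p from rfl, G.other_symm _ _ hp]; exact congrArg some (A.embG_leg k)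
  · rw [A.other'_embH hm] at h
    obtain ⟨p, hp, rfl⟩ := map_eq_some h
    rw [A.other'_embH (A.ne_xleg_of_other hp), H.other_symm _ _ hp]; rfl

/-- kernel: a line of G′ has two distinct endpoints. [cite: Balaban1983Higgs3, p.415] -/
theorem other'_ne (l l' : ILeg A.kind') (h : A.other' l = some l') : l' ≠ l := by
  rcases A.leg_cases l with ⟨w, s, rfl⟩ | ⟨k, rfl⟩ | ⟨m, hm, rfl⟩
  · rw [A.other'_inl] at h
    obtain ⟨p, hp, rfl⟩ := map_eq_some h
    intro heq
    rcases A.embG_cases p with ⟨k', rfl, hk⟩ | ⟨hpv, -⟩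
    · have := congrArg A.projG heq
      rw [hk, A.projG_X] at this
      simp [projG] at this
    · have := congrArg A.projG heq
      rw [A.projG_embG_of_ne hpv] at this
      exact G.other_ne _ _ hp (Option.some.inj this)
  · rw [A.other'_X] at h
    obtain ⟨p, hp, rfl⟩ := map_eq_some h
    intro heq
    rcases A.embG_cases p with ⟨k', rfl, hk⟩ | ⟨hpv, -⟩
    · rw [hk] at heq
      exact G.other_ne _ _ hp (by rw [A.X_injective heq])
    · have := congrArg A.projH heq
      rw [A.projH_embG_of_ne hpv, A.projH_X] at this
      simp at this
  · rw [A.other'_embH hm] at h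
    obtain ⟨p, hp, rfl⟩ := map_eq_some h
    intro heq
    have := congrArg A.projH heq
    rw [A.projH_embH, A.projH_embH] at this
    exact H.other_ne _ _ hp (Option.some.inj this)

/-- kernel: the lines of G′ preserve the leg type. [cite: Balaban1983Higgs3, p.414] -/
theorem other'_isLeft (l l' : ILeg A.kind') (h : A.other' l = some l') : l.2.isLeft = l'.2.isLeft := by
  rcases A.leg_cases l with ⟨w, s, rfl⟩ | ⟨k, rfl⟩ | ⟨m, hm, rfl⟩
  · rw [A.other'_inl] at h
    obtain ⟨p, hp, rfl⟩ := map_eq_some h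
    rw [A.isLeft_embG]
    exact G.other_isLeft _ _ hp
  · rw [A.other'_X] at h
    obtain ⟨p, hp, rfl⟩ := map_eq_some h
    rw [A.isLeft_embG, ← G.other_isLeft _ _ hp]
    rfl
  · rw [A.other'_embH hm] at h
    obtain ⟨p, hp, rfl⟩ := map_eq_some h
    obtain ⟨u, s⟩ := m
    obtain ⟨u', s'⟩ := p
    exact H.other_isLeft _ _ hp

/-- kernel: G′ has an internal line (H has one, and it is kept). [cite: Balaban1983Higgs3, p.415] -/
theorem exists_line' : ∃ l, (A.other' l).isSome := by
  obtain ⟨m, hm⟩ := H.exists_line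
  refine ⟨A.embH m, ?_⟩
  rw [A.other'_embH (A.ne_xleg_of_isSome hm)]
  simpa using hm

/-- **p. 423** [PDF 13], the graph G′ *"obtained from G by attaching the corresponding graphs to the mass renormalization
vertices"* — for one mass renormalization vertex: the ATTACHED GRAPH of the data `A` (G with v deleted and the counterterm graph
H inserted, its legs x 0, x 1 taking over the lines at the legs of v), a graph of the model over the vertex type
{w ≠ v} ⊕ (vertices of H). [cite: Balaban1983Higgs3, (2.3) p.423] -/
def attach : IGraph nbar ({w : Fin G.nV // w ≠ A.v} ⊕ Fin H.nV) where
  kind := A.kind'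
  adm i := match i with
    | .inl w => G.adm w.1
    | .inr u => H.adm u
  other := A.other'
  other_ne := A.other'_ne
  other_symm := A.other'_symm
  other_isLeft := A.other'_isLeft
  exists_line := A.exists_line'

end AttachData

end Literature.MathematicalPhysics.QuantumFieldTheory.Balaban1983to89.B3AttachCounterterm
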